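import Summits.PneNP.PneNP.Theorems.ConvexRankGatesConvexGateBlindExactLiftingTriangleIsolationKernel

/-!
# Triangle instance — line isolation, file 4: block symmetries and the usage-averaged kernel

Support file for crux `ConvexGateBlind` (stmt-PneNP-10680), open stub `stub_exactLifting`; prover seat 0, session 22,
memo ANALYSIS12 (Theorem B, §2.2). Two block permutations (swap blocks `1,2`; cyclic shift) transport every
closed-form statement from the direction `{(a,b,·)}` to the other two. Then THE KERNEL of the averaged identity,
`ker L w = ∑_x [L mono under x] · wt x w` (the cube functional of the rows USING the line `L`, evaluated at `w`):
* `ker L w = (∑_y dc y d') · J` with `J = ∑_{x₀,x₁} [x₀ a = x₁ b] [x₀ a' ≠ x₁ b'] dc x₀ a' · dc x₁ b' ≥ 0`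
  (the free block is summed first: if the two fixed coordinates of `w` disagree in colour the sign is `+1`
  throughout, if they agree the signed block sum vanishes by `y ↦ ¬y`);
* hence `ker L w = 0` for `w ∈ L` (`ker_eq_zero_of_lmem`) and
  `(t−1)(t−2)² 2^{3t} ≤ 128 · ker L w` for `w ∉ L` (`ker_ge_of_not_lmem`): the kernel is SIGN-DEFINITE.
Also the three-direction forms of the values of `ψ^x` on line indicators.
-/

set_option linter.dupNamespace false -- `Summit.PneNP.PneNP.…`: summit = sub-problem (D-0017)

namespace Summit.PneNP.PneNP.Theorems.XorDoor.TriLine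

open Finset

noncomputable section

variable {t : ℕ}

/-! ## Block permutations -/

/-- swap blocks `1` and `2` of a colouring -/
def swC (x : Col t) : Col t := (x.1, x.2.2, x.2.1)
/-- swap coordinates `1` and `2` of a triangle -/
def swT (w : Tri t) : Tri t := (w.1, w.2.2, w.2.1)
/-- cyclic shift of the blocks of a colouring -/
def cyC (x : Col t) : Col t := (x.2.1, x.2.2, x.1)
/-- cyclic shift of the coordinates of a triangle -/
def cyT (w : Tri t) : Tri t := (w.2.1, w.2.2, w.1)

/-- swapping blocks twice is the identity -/
lemma swC_involutive : Function.Involutive (swC (t := t)) := fun _ => rfl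
/-- swapping coordinates twice is the identity -/
lemma swT_involutive : Function.Involutive (swT (t := t)) := fun _ => rfl
/-- the cyclic shift of blocks is a bijection -/
lemma cyC_bijective : Function.Bijective (cyC (t := t)) :=
  ⟨fun x x' h => by
    have h1 := congrArg Prod.fst h; have h2 := congrArg (fun z => z.2.1) h
    have h3 := congrArg (fun z => z.2.2) h
    simp only [cyC] at h1 h2 h3
    exact Prod.ext h3 (Prod.ext h1 h2),
   fun x => ⟨(x.2.2, x.1, x.2.1), rfl⟩⟩
/-- the cyclic shift of coordinates is a bijection -/
lemma cyT_bijective : Function.Bijective (cyT (t := t)) :=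
  ⟨fun w w' h => by
    have h1 := congrArg Prod.fst h; have h2 := congrArg (fun z => z.2.1) h
    have h3 := congrArg (fun z => z.2.2) h
    simp only [cyT] at h1 h2 h3
    exact Prod.ext h3 (Prod.ext h1 h2),
   fun w => ⟨(w.2.2, w.1, w.2.1), rfl⟩⟩

/-- the weights are invariant under the simultaneous swap -/
@[simp] lemma wt_swC_swT (x : Col t) (w : Tri t) : wt (swC x) (swT w) = wt x w := by
  unfold wt sgn nw IsMono swC swT
  simp only [and_comm]
  ring_nf

/-- the weights are invariant under the simultaneous cyclic shift -/
@[simp] lemma wt_cyC_cyT (x : Col t) (w : Tri t) : wt (cyC x) (cyT w) = wt x w := by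
  unfold wt sgn nw IsMono cyC cyT
  have h : (x.2.1 w.2.1 = x.2.2 w.2.2 ∧ x.2.1 w.2.1 = x.1 w.1) ↔ (x.1 w.1 = x.2.1 w.2.1 ∧ x.1 w.1 = x.2.2 w.2.2) := by
    constructor
    · rintro ⟨h1, h2⟩; exact ⟨h2.symm, h2.symm.trans h1⟩
    · rintro ⟨h1, h2⟩; exact ⟨h1.symm.trans h2, h1.symm⟩
  simp only [h]
  ring_nf

/-- `μ` is invariant under the swap -/
@[simp] lemma mu_swC (x : Col t) : mu (swC x) = mu x := by unfold mu swC; ring_nf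
/-- `μ` is invariant under the cyclic shift -/
@[simp] lemma mu_cyC (x : Col t) : mu (cyC x) = mu x := by unfold mu cyC; ring_nf

/-- a line `{(a,·,d)}` is the swap of the line `{(a,d,·)}` -/
@[simp] lemma lind_inl_swT (a d : Fin t) (w : Tri t) :
    lind (Sum.inl (a, d)) (swT w) = lind (Sum.inr (Sum.inl (a, d))) w := by
  unfold lind; simp [swT]
/-- a line `{(·,b,d)}` is the shift of the line `{(b,d,·)}` -/
@[simp] lemma lind_inl_cyT (b d : Fin t) (w : Tri t) :
    lind (Sum.inl (b, d)) (cyT w) = lind (Sum.inr (Sum.inr (b, d))) w := by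
  unfold lind; simp [cyT]

/-! ## `ψ^x` on line indicators, all three directions -/

/-- direction `{(a,·,d)}` reduced to `{(a,d,·)}` of the swapped colouring -/
lemma psi_lind_inr_inl (x : Col t) (a d : Fin t) :
    ∑ w : Tri t, wt x w * lind (Sum.inr (Sum.inl (a, d))) w = ∑ b, wt (swC x) (a, d, b) := by
  rw [← sum_wt_lind_inl (swC x) a d]
  exact Fintype.sum_bijective swT swT_involutive.bijective (fun w => wt x w * lind (Sum.inr (Sum.inl (a, d))) w)
    (fun w => wt (swC x) w * lind (Sum.inl (a, d)) w) fun w => by rw [wt_swC_swT, lind_inl_swT]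

/-- direction `{(·,b,d)}` reduced to `{(b,d,·)}` of the shifted colouring -/
lemma psi_lind_inr_inr (x : Col t) (b d : Fin t) :
    ∑ w : Tri t, wt x w * lind (Sum.inr (Sum.inr (b, d))) w = ∑ a, wt (cyC x) (b, d, a) := by
  rw [← sum_wt_lind_inl (cyC x) b d]
  exact Fintype.sum_bijective cyT cyT_bijective (fun w => wt x w * lind (Sum.inr (Sum.inr (b, d))) w)
    (fun w => wt (cyC x) w * lind (Sum.inl (b, d)) w) fun w => by rw [wt_cyC_cyT, lind_inl_cyT]

/-- `ψ^x(1_L) = 0` on a monochromatic line -/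
lemma psi_lind_mono (x : Col t) {L : Line t} (h : lmono x L) : ∑ w : Tri t, wt x w * lind L w = 0 := by
  rcases L with ⟨a, b⟩ | ⟨a, d⟩ | ⟨b, d⟩
  · rw [sum_wt_lind_inl]; exact sum_wt_line_inl_mono x h
  · rw [psi_lind_inr_inl]; exact sum_wt_line_inl_mono (swC x) h
  · rw [psi_lind_inr_inr]; exact sum_wt_line_inl_mono (cyC x) h

/-- `0 ≤ ψ^x(1_L)` always -/
lemma psi_lind_nonneg (x : Col t) (L : Line t) : 0 ≤ ∑ w : Tri t, wt x w * lind L w := by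
  by_cases h : lmono x L
  · exact (psi_lind_mono x h).ge
  rcases L with ⟨a, b⟩ | ⟨a, d⟩ | ⟨b, d⟩
  · rw [sum_wt_lind_inl, sum_wt_line_inl_bichro x h]; positivity
  · rw [psi_lind_inr_inl, sum_wt_line_inl_bichro (swC x) h]; positivity
  · rw [psi_lind_inr_inr, sum_wt_line_inl_bichro (cyC x) h]; positivity

/-- `2 μ(x) ≤ t² ψ^x(1_L)` on a bichromatic line -/
lemma psi_lind_bichro (x : Col t) {L : Line t} (h : ¬ lmono x L) :
    2 * mu x ≤ (t : ℝ) ^ 2 * ∑ w : Tri t, wt x w * lind L w := by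
  rcases L with ⟨a, b⟩ | ⟨a, d⟩ | ⟨b, d⟩
  · rw [sum_wt_lind_inl]; exact two_mul_mu_le_inl x h
  · rw [psi_lind_inr_inl, ← mu_swC]; exact two_mul_mu_le_inl (swC x) h
  · rw [psi_lind_inr_inr, ← mu_cyC]; exact two_mul_mu_le_inl (cyC x) h

/-! ## The usage-averaged kernel -/

/-- `ker L w = ∑_x [L mono under x] wt x w` -/
def ker (L : Line t) (w : Tri t) : ℝ := ∑ x : Col t, (if lmono x L then wt x w else 0)

/-- the coupled two-block sum `J = ∑_{x₀,x₁} [x₀ a = x₁ b ∧ x₀ a' ≠ x₁ b'] dc x₀ a' · dc x₁ b'` -/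
def Jker (a b a' b' : Fin t) : ℝ :=
  ∑ x₀ : Fin t → Bool, ∑ x₁ : Fin t → Bool,
    (if x₀ a = x₁ b ∧ x₀ a' ≠ x₁ b' then (dc x₀ a' : ℝ) * dc x₁ b' else 0)

/-- `J ≥ 0` termwise -/
lemma Jker_nonneg (a b a' b' : Fin t) : 0 ≤ Jker a b a' b' := by
  unfold Jker
  refine sum_nonneg fun x₀ _ => sum_nonneg fun x₁ _ => ?_
  split_ifs <;> positivity

/-- **Factorisation of the kernel** (the free block summed first): `ker {(a,b,·)} (a',b',d') = (∑_y dc y d') · J`. -/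
lemma ker_inl_eq (a b a' b' d' : Fin t) :
    ker (Sum.inl (a, b)) (a', b', d') = (∑ y : Fin t → Bool, (dc y d' : ℝ)) * Jker a b a' b' := by
  unfold ker Jker
  rw [Fintype.sum_prod_type, mul_sum]
  refine sum_congr rfl fun x₀ _ => ?_
  rw [Fintype.sum_prod_type, mul_sum]
  refine sum_congr rfl fun x₁ _ => ?_
  simp only [lmono_inl]
  by_cases hab : x₀ a = x₁ b
  · simp only [hab, true_and, if_true]
    by_cases huv : x₀ a' = x₁ b'
    · -- agreeing fixed coordinates of `w`: the signed free-block sum vanishes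
      rw [if_neg (not_not.mpr huv), mul_zero]
      have hs : ∀ x₂ : Fin t → Bool, wt (x₀, x₁, x₂) (a', b', d')
          = (dc x₀ a' : ℝ) * dc x₁ b' * ((if x₂ d' = x₀ a' then (-1 : ℝ) else 1) * dc x₂ d') := by
        intro x₂
        unfold wt sgn nw IsMono
        simp only [huv, true_and]
        by_cases hd : x₂ d' = x₁ b'
        · rw [if_pos hd.symm, if_pos hd]; ring
        · rw [if_neg (Ne.symm hd), if_neg hd]; ring
      simp only [hs, ← mul_sum, sum_sign_mul_dc_eq_zero, mul_zero]
    · rw [if_pos huv]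
      have hs : ∀ x₂ : Fin t → Bool, wt (x₀, x₁, x₂) (a', b', d')
          = (dc x₀ a' : ℝ) * dc x₁ b' * dc x₂ d' := by
        intro x₂
        unfold wt sgn nw IsMono
        rw [if_neg (fun hm => huv hm.1)]
        ring
      simp only [hs, ← mul_sum]
      ring
  · simp only [hab, false_and, if_false, sum_const_zero, mul_zero]

/-- the kernel vanishes ON the line (direction `{(a,b,·)}`) -/
lemma Jker_self (a b : Fin t) : Jker a b a b = 0 := by
  unfold Jker
  refine sum_eq_zero fun x₀ _ => sum_eq_zero fun x₁ _ => ?_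
  rw [if_neg]
  exact fun h => h.2 h.1

/-- restricting `J` to a product of prescribed sub-families where both conditions hold -/
lemma Jker_ge_prod (a b a' b' : Fin t) (c₀ c₁ : Bool) (hne : c₀ ≠ c₁) :
    (∑ x₀ ∈ univ.filter (fun y : Fin t → Bool => y a = true ∧ y a' = c₀), (dc x₀ a' : ℝ))
      * (∑ x₁ ∈ univ.filter (fun y : Fin t → Bool => y b = true ∧ y b' = c₁), (dc x₁ b' : ℝ))
      ≤ Jker a b a' b' := by
  rw [sum_mul_sum]
  unfold Jker
  calc ∑ x₀ ∈ univ.filter (fun y : Fin t → Bool => y a = true ∧ y a' = c₀),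
        ∑ x₁ ∈ univ.filter (fun y : Fin t → Bool => y b = true ∧ y b' = c₁), (dc x₀ a' : ℝ) * dc x₁ b'
      = ∑ x₀ ∈ univ.filter (fun y : Fin t → Bool => y a = true ∧ y a' = c₀),
          ∑ x₁ ∈ univ.filter (fun y : Fin t → Bool => y b = true ∧ y b' = c₁),
            (if x₀ a = x₁ b ∧ x₀ a' ≠ x₁ b' then (dc x₀ a' : ℝ) * dc x₁ b' else 0) := by
        refine sum_congr rfl fun x₀ h₀ => sum_congr rfl fun x₁ h₁ => ?_
        simp only [mem_filter, mem_univ, true_and] at h₀ h₁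
        rw [if_pos]
        refine ⟨by rw [h₀.1, h₁.1], ?_⟩
        rw [h₀.2, h₁.2]
        exact hne
    _ ≤ ∑ x₀ ∈ univ.filter (fun y : Fin t → Bool => y a = true ∧ y a' = c₀), ∑ x₁,
            (if x₀ a = x₁ b ∧ x₀ a' ≠ x₁ b' then (dc x₀ a' : ℝ) * dc x₁ b' else 0) := by
        refine sum_le_sum fun x₀ _ => sum_le_univ_sum_of_nonneg fun x₁ => ?_
        split_ifs <;> positivity
    _ ≤ _ := by
        refine sum_le_univ_sum_of_nonneg fun x₀ => sum_nonneg fun x₁ _ => ?_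
        split_ifs <;> positivity

/-- **Positivity constant of the kernel** off the line (direction `{(a,b,·)}`):
`((t−2) 2^t)² ≤ 64 J` whenever `(a',b') ≠ (a,b)`. -/
lemma Jker_ge (a b a' b' : Fin t) (h : ¬ (a' = a ∧ b' = b)) :
    (((t - 2 : ℕ) : ℝ) * 2 ^ t) ^ 2 ≤ 64 * Jker a b a' b' := by
  -- choose the prescribed colours so that both kernel conditions hold on the product family
  have key : ∀ c₀ c₁ : Bool, c₀ ≠ c₁ → (a = a' → true = c₀) → (b = b' → true = c₁) →
      (((t - 2 : ℕ) : ℝ) * 2 ^ t) ^ 2 ≤ 64 * Jker a b a' b' := by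
    intro c₀ c₁ hne h₀ h₁
    have g₀ := sum_dc_fix2_ge a a' true c₀ h₀
    have g₁ := sum_dc_fix2_ge b b' true c₁ h₁
    have g₀' : ((t - 2 : ℕ) : ℝ) * 2 ^ t
        ≤ 8 * ∑ x₀ ∈ univ.filter (fun y : Fin t → Bool => y a = true ∧ y a' = c₀), (dc x₀ a' : ℝ) := by
      exact_mod_cast g₀
    have g₁' : ((t - 2 : ℕ) : ℝ) * 2 ^ t
        ≤ 8 * ∑ x₁ ∈ univ.filter (fun y : Fin t → Bool => y b = true ∧ y b' = c₁), (dc x₁ b' : ℝ) := by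
      exact_mod_cast g₁
    have hJ := Jker_ge_prod a b a' b' c₀ c₁ hne
    have hnn : (0 : ℝ) ≤ ((t - 2 : ℕ) : ℝ) * 2 ^ t := by positivity
    calc (((t - 2 : ℕ) : ℝ) * 2 ^ t) ^ 2 = (((t - 2 : ℕ) : ℝ) * 2 ^ t) * (((t - 2 : ℕ) : ℝ) * 2 ^ t) := sq _
      _ ≤ (8 * ∑ x₀ ∈ univ.filter (fun y : Fin t → Bool => y a = true ∧ y a' = c₀), (dc x₀ a' : ℝ))
          * (8 * ∑ x₁ ∈ univ.filter (fun y : Fin t → Bool => y b = true ∧ y b' = c₁), (dc x₁ b' : ℝ)) :=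
          mul_le_mul g₀' g₁' hnn ((hnn.trans g₀'))
      _ ≤ 64 * Jker a b a' b' := by linarith
  by_cases hbb : b = b'
  · have haa : a ≠ a' := fun haa => h ⟨haa.symm, hbb.symm⟩
    exact key false true (by decide) (fun haa' => (haa haa').elim) (fun _ => rfl)
  · exact key true false (by decide) (fun _ => rfl) (fun hbb' => (hbb hbb').elim)

/-! ### Transport to the other two directions -/

/-- transport of the kernel, direction `{(a,·,d)}` -/
lemma ker_inr_inl (a d : Fin t) (w : Tri t) :
    ker (Sum.inr (Sum.inl (a, d))) w = ker (Sum.inl (a, d)) (swT w) := by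
  unfold ker
  refine Fintype.sum_bijective swC swC_involutive.bijective _ _ fun x => ?_
  rw [wt_swC_swT]
  simp only [lmono_inl, lmono_inr_inl, swC]

/-- transport of the kernel, direction `{(·,b,d)}` -/
lemma ker_inr_inr (b d : Fin t) (w : Tri t) :
    ker (Sum.inr (Sum.inr (b, d))) w = ker (Sum.inl (b, d)) (cyT w) := by
  unfold ker
  refine Fintype.sum_bijective cyC cyC_bijective _ _ fun x => ?_
  rw [wt_cyC_cyT]
  simp only [lmono_inl, lmono_inr_inr, cyC]

/-- **The kernel vanishes on the line.** -/
theorem ker_eq_zero_of_lmem {L : Line t} {w : Tri t} (h : lmem L w) : ker L w = 0 := by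
  obtain ⟨a', b', d'⟩ := w
  rcases L with ⟨a, b⟩ | ⟨a, d⟩ | ⟨b, d⟩
  · simp only [lmem_inl] at h
    rw [ker_inl_eq, ← h.1, ← h.2, Jker_self, mul_zero]
  · simp only [lmem_inr_inl] at h
    rw [ker_inr_inl, swT, ker_inl_eq, ← h.1, ← h.2, Jker_self, mul_zero]
  · simp only [lmem_inr_inr] at h
    rw [ker_inr_inr, cyT, ker_inl_eq, ← h.1, ← h.2, Jker_self, mul_zero]

/-- the kernel in closed-bound form, direction `{(a,b,·)}` -/
lemma ker_inl_ge (a b a' b' d' : Fin t) (h : ¬ (a' = a ∧ b' = b)) :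
    ((t - 1 : ℕ) : ℝ) * 2 ^ t * (((t - 2 : ℕ) : ℝ) * 2 ^ t) ^ 2 ≤ 128 * ker (Sum.inl (a, b)) (a', b', d') := by
  rw [ker_inl_eq]
  have hF : 2 * ∑ y : Fin t → Bool, (dc y d' : ℝ) = ((t - 1 : ℕ) : ℝ) * 2 ^ t := by
    exact_mod_cast two_mul_sum_dc d'
  have hJ := Jker_ge a b a' b' h
  have hFnn : (0 : ℝ) ≤ ∑ y : Fin t → Bool, (dc y d' : ℝ) := by positivity
  calc ((t - 1 : ℕ) : ℝ) * 2 ^ t * (((t - 2 : ℕ) : ℝ) * 2 ^ t) ^ 2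
      = (2 * ∑ y : Fin t → Bool, (dc y d' : ℝ)) * (((t - 2 : ℕ) : ℝ) * 2 ^ t) ^ 2 := by rw [hF]
    _ ≤ (2 * ∑ y : Fin t → Bool, (dc y d' : ℝ)) * (64 * Jker a b a' b') := by gcongr
    _ = 128 * ((∑ y : Fin t → Bool, (dc y d' : ℝ)) * Jker a b a' b') := by ring

/-- **The kernel is bounded below off the line**: `(t−1)(t−2)² 2^{3t} ≤ 128 · ker L w` for `w ∉ L`. -/
theorem ker_ge_of_not_lmem {L : Line t} {w : Tri t} (h : ¬ lmem L w) :
    ((t - 1 : ℕ) : ℝ) * 2 ^ t * (((t - 2 : ℕ) : ℝ) * 2 ^ t) ^ 2 ≤ 128 * ker L w := by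
  obtain ⟨a', b', d'⟩ := w
  rcases L with ⟨a, b⟩ | ⟨a, d⟩ | ⟨b, d⟩
  · simp only [lmem_inl] at h
    exact ker_inl_ge a b a' b' d' h
  · simp only [lmem_inr_inl] at h
    rw [ker_inr_inl, swT]
    exact ker_inl_ge a d a' d' b' h
  · simp only [lmem_inr_inr] at h
    rw [ker_inr_inr, cyT]
    exact ker_inl_ge b d b' d' a' h

/-- the kernel is non-negative everywhere -/
lemma ker_nonneg (L : Line t) (w : Tri t) : 0 ≤ ker L w := by
  by_cases h : lmem L w
  · exact (ker_eq_zero_of_lmem h).ge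
  · have := ker_ge_of_not_lmem h
    have h0 : (0 : ℝ) ≤ ((t - 1 : ℕ) : ℝ) * 2 ^ t * (((t - 2 : ℕ) : ℝ) * 2 ^ t) ^ 2 := by positivity
    linarith


/-- **The usage-averaged kernel vanishes on the line** — registered sub-goal `kernel_vanishes_on_line` of
stmt-PneNP-10680, verbatim signature (see `ker_eq_zero_of_lmem`): for the line `{(a,b,·)}` and its point `(a,b,d)`,
`∑_x [x₀ a = x₁ b] ± N₀(a) N₁(b) N₂(d) = 0`. -/
theorem kernel_vanishes_on_line : ∀ (t : ℕ) (a b d : Fin t), ∑ x : (Fin t → Bool) × (Fin t → Bool) × (Fin t → Bool),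
    (if x.1 a = x.2.1 b then (if x.1 a = x.2.1 b ∧ x.1 a = x.2.2 d then (-1 : ℝ) else 1) * (((Finset.univ.filter fun v
    => x.1 v ≠ x.1 a).card : ℝ) * ((Finset.univ.filter fun v => x.2.1 v ≠ x.2.1 b).card : ℝ) * ((Finset.univ.filter fun
    v => x.2.2 v ≠ x.2.2 d).card : ℝ)) else 0) = 0 := by
  intro t a b d
  have h := ker_eq_zero_of_lmem (L := Sum.inl (a, b)) (w := (a, b, d)) (by simp)
  unfold ker wt sgn nw IsMono dc at h
  simpa using h

end

end Summit.PneNP.PneNP.Theorems.XorDoor.TriLine
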